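import Mathlib
import Summits.Ventures.HodgeRepro.Tier4.Common.AdelicDefs
import Summits.Ventures.HodgeRepro.Tier4.Common.AdicResidue

/-!
# Tier4/Common/AdelicHaar — the adelic unitary group and its tori are locally compact Hausdorff groups, hence carry
Haar measures (the Haar half of `exists_rtfData_isHaar`, S12378 / S12373)

Blind re-derivation cell `pub-hodge-repro`, Tier 4 (README §9–§10), seat t4-typer-2 (gen 0).  Target tree path
`lean/Summits/Ventures/HodgeRepro/Tier4/Common/AdelicHaar.lean`.  Imports `Tier4/Common/AdelicDefs.lean`
(`GA W`, `torusT`, `torusT'`, `commutant`, `unitaryGroup`) and `Tier4/Common/AdicResidue.lean`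
(`locallyCompactSpace_adeleRing`).

CHAIN.  `𝔸_k` locally compact (`AdicResidue`) ⇒ `M₄(𝔸_k)` locally compact (finite product) ⇒ `GL₄(𝔸_k)` locally
compact (the units topology is a CLOSED embedding into `M₄ × M₄ᵐᵒᵖ`, Mathlib's `Units.isClosedEmbedding_embedProduct`,
`𝔸_k` being T2) ⇒ every CLOSED subgroup is locally compact (`IsClosed.locallyCompactSpace`); `unitaryGroup W`, the
`commutant`s and hence the tori are closed (preimages of closed sets under the continuous matrix operations).  With
`T2Space` (inherited) and the Borel σ-algebra, Mathlib's `MeasureTheory.Measure.haar` is a Haar measure: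
**`exists_isHaarMeasure_GA`**, **`exists_isHaarMeasure_torusT`**, **`exists_isHaarMeasure_torusT'`** (stated with the
Borel σ-algebra made explicit, so that no instance is declared in this file — typer lint rule).  What remains for
`RTFData.IsHaar` is (M2): a measurable fundamental domain of the rational points in each torus.

Nothing here says anything about the status of the Hodge conjecture for CM abelian varieties, which is NOT proved
(HC_CM is NOT proved by anyone in this repository).
-/

set_option autoImplicit false

noncomputable section

namespace Summit.Ventures.HodgeRepro.Tier4.Common

open NumberField Matrix Topology MeasureTheory IsDedekindDomain
open scoped NumberField

section LocallyCompact

variable (k : Type) [Field k] [NumberField k]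

/-- `𝔸_k` is Hausdorff (a product of Hausdorff spaces: the completions at the infinite places and the restricted
product of the completions at the finite places). -/
theorem t2Space_adeleRing : T2Space (Ad k) := by
  haveI : T2Space (InfiniteAdeleRing k) :=
    inferInstanceAs (T2Space ((v : InfinitePlace k) → v.Completion))
  haveI : T2Space (FiniteAdeleRing (𝓞 k) k) :=
    inferInstanceAs (T2Space (RestrictedProduct (fun v : IsDedekindDomain.HeightOneSpectrum (𝓞 k) => v.adicCompletion k)
      (fun v => (v.adicCompletionIntegers k : Set (v.adicCompletion k))) Filter.cofinite))
  exact inferInstanceAs (T2Space (InfiniteAdeleRing k × FiniteAdeleRing (𝓞 k) k))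

/-- `M₄(𝔸_k)` is Hausdorff. -/
theorem t2Space_M4 : T2Space (M4 k) := by
  haveI := t2Space_adeleRing k
  exact inferInstanceAs (T2Space (Fin 4 → Fin 4 → Ad k))

/-- `M₄(𝔸_k)` is locally compact. -/
theorem locallyCompactSpace_M4 : LocallyCompactSpace (M4 k) := by
  haveI := locallyCompactSpace_adeleRing k
  exact inferInstanceAs (LocallyCompactSpace (Fin 4 → Fin 4 → Ad k))

/-- `GL₄(𝔸_k)` is locally compact (closed embedding into `M₄ × M₄ᵐᵒᵖ`). -/
theorem locallyCompactSpace_GL4 : LocallyCompactSpace (GL4 k) := by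
  haveI := locallyCompactSpace_M4 k
  haveI := t2Space_M4 k
  exact (Units.isClosedEmbedding_embedProduct (α := M4 k)).locallyCompactSpace

variable {k} (W : PlaneData k)

/-- The carrier of the unitary group is closed in `GL₄(𝔸_k)`. -/
theorem isClosed_unitaryGroup : IsClosed ((unitaryGroup W : Set (GL4 k))) := by
  haveI := t2Space_M4 k
  have hcoe : Continuous fun g : GL4 k => (↑g : M4 k) := Units.continuous_val
  have h1 : IsClosed {g : GL4 k | (↑g : M4 k) * adMat k W.Ω = adMat k W.Ω * (↑g : M4 k)} :=
    isClosed_eq (hcoe.matrix_mul continuous_const) (continuous_const.matrix_mul hcoe)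
  have h2 : IsClosed {g : GL4 k | (↑g : M4 k) * adMat k W.B * (↑g : M4 k)ᵀ = adMat k W.B} :=
    isClosed_eq ((hcoe.matrix_mul continuous_const).matrix_mul hcoe.matrix_transpose) continuous_const
  exact h1.inter h2

/-- **`G(𝔸_k)` is locally compact.** -/
theorem locallyCompactSpace_GA : LocallyCompactSpace (GA W) := by
  haveI := locallyCompactSpace_GL4 k
  exact (isClosed_unitaryGroup W).locallyCompactSpace

/-- The commutant of a `k`-matrix is closed in `G(𝔸_k)`. -/
theorem isClosed_commutant (A : Matrix (Fin 4) (Fin 4) k) : IsClosed ((commutant W A : Set (GA W))) := by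
  haveI := t2Space_M4 k
  have hcoe : Continuous fun g : GA W => GA.mat W g :=
    Units.continuous_val.comp continuous_subtype_val
  exact isClosed_eq (hcoe.matrix_mul continuous_const) (continuous_const.matrix_mul hcoe)

/-- The torus `T` is closed in `G(𝔸_k)`. -/
theorem isClosed_torusT : IsClosed ((torusT W : Set (GA W))) :=
  (isClosed_commutant W (W.P 0)).inter (isClosed_commutant W (W.P 1))

/-- The torus `T′` is closed in `G(𝔸_k)`. -/
theorem isClosed_torusT' : IsClosed ((torusT' W : Set (GA W))) :=
  (isClosed_commutant W (W.Q 0)).inter (isClosed_commutant W (W.Q 1))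

/-- **`T(𝔸_k)` is locally compact.** -/
theorem locallyCompactSpace_torusT : LocallyCompactSpace (torusT W) := by
  haveI := locallyCompactSpace_GA W
  exact (isClosed_torusT W).locallyCompactSpace

/-- **`T′(𝔸_k)` is locally compact.** -/
theorem locallyCompactSpace_torusT' : LocallyCompactSpace (torusT' W) := by
  haveI := locallyCompactSpace_GA W
  exact (isClosed_torusT' W).locallyCompactSpace

end LocallyCompact

section Haar

variable {k : Type} [Field k] [NumberField k] (W : PlaneData k)

/-- **A Haar measure on `G(𝔸_k)` exists** (with the Borel σ-algebra). -/
theorem exists_isHaarMeasure_GA :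
    ∃ μ : @Measure (GA W) (borel (GA W)), @Measure.IsHaarMeasure (GA W) _ _ (borel (GA W)) μ := by
  haveI := locallyCompactSpace_GA W
  haveI := t2Space_M4 k
  letI : MeasurableSpace (GA W) := borel (GA W)
  haveI : BorelSpace (GA W) := ⟨rfl⟩
  exact ⟨Measure.haar, inferInstance⟩

/-- **A Haar measure on `T(𝔸_k)` exists.** -/
theorem exists_isHaarMeasure_torusT :
    ∃ μ : @Measure (torusT W) (borel (torusT W)), @Measure.IsHaarMeasure (torusT W) _ _ (borel (torusT W)) μ := by
  haveI := locallyCompactSpace_torusT W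
  haveI := t2Space_M4 k
  letI : MeasurableSpace (torusT W) := borel (torusT W)
  haveI : BorelSpace (torusT W) := ⟨rfl⟩
  exact ⟨Measure.haar, inferInstance⟩

/-- **A Haar measure on `T′(𝔸_k)` exists.** -/
theorem exists_isHaarMeasure_torusT' :
    ∃ μ : @Measure (torusT' W) (borel (torusT' W)), @Measure.IsHaarMeasure (torusT' W) _ _ (borel (torusT' W)) μ := by
  haveI := locallyCompactSpace_torusT' W
  haveI := t2Space_M4 k
  letI : MeasurableSpace (torusT' W) := borel (torusT' W)
  haveI : BorelSpace (torusT' W) := ⟨rfl⟩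
  exact ⟨Measure.haar, inferInstance⟩

end Haar

end Summit.Ventures.HodgeRepro.Tier4.Common

end
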